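import Literature.GroupTheory.ArithmeticGroups.SL2PrimePowSchurMultiplier
import Literature.NumberTheory.Automorphic.UnboundedDenominatorsInvariantHomRealization
import Literature.NumberTheory.Automorphic.UnboundedDenominatorsInvariantHomCrossCommutator
import Literature.NumberTheory.Automorphic.WohlfahrtTheorem
import HarnessLib

/-!
# The invariant form of CDT Cor. 4.5.3: the local condition at `ℓ = p ≥ 5`, `p² ∣ N` (the hard residue)

In the language of `UnboundedDenominatorsInvariantHomRealization` / `…Gluing`: for an `SL₂(ℤ)`-conjugation-
invariant `θ : Γ(N) → Q` a subgroup `X ≥ Γ(N)` satisfies the LOCAL CONDITION if `θ` kills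
`Γ(N) ∩ ([X, X]·K_θ)`, i.e. in the central extension `SL₂(ℤ)/K_θ → SL₂(ℤ/N)` the commutator subgroup of the
image of `X` meets the centre trivially.  The gluing reduces the invariant form of
[CalegariDimitrovTang2025, Corollary 4.5.3] at level `N = ∏ q^{f_q}` to the local conditions for
`X = Γ(N/q^{f_q})`, whose images are central extensions of the factors `SL₂(ℤ/q^{f_q})`.  The tree's Sylow-local
files handle the targets of order prime to `q` (cyclic / dicyclic Sylow subgroups) and the prime levels.  This
file supplies the remaining case `ℓ = q = p ≥ 5` with `p² ∣ N` allowed: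

* `local_condition_primePow` / `local_condition_of_eq_primePow_mul` — for `N = p^e M`, `p ∤ M`, `p ≥ 5` and
  `Q` of exponent `p`, the local condition holds for `X = Γ(M)`: the image `Γ(M)/(K_θ ∩ Γ(M))` is a central
  exponent-`p` extension of `SL₂(ℤ/p^e)` (strong approximation `IharaAmalgam.exists_mem_Gamma_forall_dvd_sub`),
  and the `p`-primary part of the Schur multiplier of `SL₂(ℤ/p^e)` vanishes
  (`SL2SchurMultiplier.eq_one_of_mem_ker_of_mem_commutator`, [Beyl1986], proved in the tree by an elementary
  descent);
* `cor453_invariant_form_primePow_of_exponent` — consequently at prime-power level `N = p^e`, `p ≥ 5`, every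
  invariant `θ : Γ(p^e) → Q` with `Q` finite commutative of exponent `p` kills `Γ(12 p^e)`.

Not here: `p = 2` with `4 ∣ N` (where the statement changes: `M(SL₂(ℤ/2^e)) = ℤ/2`) and `p = 3` with `9 ∣ N`.
-/

open scoped MatrixGroups

namespace Literature.NumberTheory.Automorphic

namespace UnboundedDenominators

open CongruenceSubgroup Matrix.SpecialLinearGroup
open Literature.GroupTheory.ArithmeticGroups

variable {Q : Type*} [CommGroup Q]
/-- Reduction `SL₂(ℤ) → SL₂(ℤ/n)` identifies matrices that are congruent modulo `n`. [cite: DiamondShurman2005,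
Exercise 1.2.2] -/
theorem map_eq_map_of_forall_dvd_sub {n : ℕ} {γ B : SL(2, ℤ)} (h : ∀ i j, (n : ℤ) ∣ γ i j - B i j) :
    Matrix.SpecialLinearGroup.map (Int.castRingHom (ZMod n)) γ =
      Matrix.SpecialLinearGroup.map (Int.castRingHom (ZMod n)) B := by
  ext i j
  have := (ZMod.intCast_zmod_eq_zero_iff_dvd _ n).mpr (h i j)
  rw [Int.cast_sub, sub_eq_zero] at this
  simpa using this

section
variable {N M : ℕ} (θ : Gamma N →* Q)
  (hθ : ∀ (g x : SL(2, ℤ)) (hx : x ∈ Gamma N) (hgx : g * x * g⁻¹ ∈ Gamma N), θ ⟨g * x * g⁻¹, hgx⟩ = θ ⟨x, hx⟩)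

/-- Membership in `K_θ = θ.ker.map Γ(N).subtype` seen inside `Γ(M)`. [cite: CalegariDimitrovTang2025, Corollary
4.5.3] -/
theorem mem_subgroupOf_ker_iff (g : Gamma M) :
    g ∈ (θ.ker.map (Gamma N).subtype).subgroupOf (Gamma M) ↔ ∃ hg : (g : SL(2, ℤ)) ∈ Gamma N, θ ⟨g, hg⟩ = 1 := by
  rw [Subgroup.mem_subgroupOf, mem_ker_map_subtype_iff]

include hθ in

/-- For `SL₂(ℤ)`-invariant `θ` on `Γ(N)`, the commutator of an element of `Γ(M)` over `Γ(N)` with any element of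
`Γ(M)` lies in `K_θ`: the image of `Γ(N)` in `Γ(M)/K_θ` is central. [cite: CalegariDimitrovTang2025, Corollary
4.5.3] -/
theorem comm_mem_subgroupOf_ker (x y : Gamma M) (hxN : (x : SL(2, ℤ)) ∈ Gamma N) :
    (y * x)⁻¹ * (x * y) ∈ (θ.ker.map (Gamma N).subtype).subgroupOf (Gamma M) := by
  rw [mem_subgroupOf_ker_iff]
  have h1 : (y : SL(2,ℤ))⁻¹ * x * (y : SL(2, ℤ))⁻¹⁻¹ ∈ Gamma N :=
    (Gamma_normal N).conj_mem _ hxN (y : SL(2, ℤ))⁻¹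
  have h2 : (x : SL(2, ℤ))⁻¹ * ((y : SL(2,ℤ))⁻¹ * x * (y : SL(2, ℤ))⁻¹⁻¹) ∈ Gamma N :=
    mul_mem (inv_mem hxN) h1
  have hcoe : (((y * x)⁻¹ * (x * y) : Gamma M) : SL(2, ℤ)) =
      (x : SL(2, ℤ))⁻¹ * ((y : SL(2,ℤ))⁻¹ * x * (y : SL(2, ℤ))⁻¹⁻¹) := by
    simp only [Subgroup.coe_mul, Subgroup.coe_inv, mul_inv_rev, inv_inv, mul_assoc]
  refine ⟨by rw [hcoe]; exact h2, ?_⟩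
  have : (⟨(((y * x)⁻¹ * (x * y) : Gamma M) : SL(2, ℤ)), by rw [hcoe]; exact h2⟩ : Gamma N) =
      ⟨(x : SL(2,ℤ)), hxN⟩⁻¹ * ⟨(y : SL(2,ℤ))⁻¹ * x * (y : SL(2, ℤ))⁻¹⁻¹, h1⟩ :=
    Subtype.ext hcoe
  rw [this, map_mul, map_inv, hθ _ _ hxN h1, inv_mul_cancel]

/-- If `Q` has exponent `p`, the `p`-th power of an element of `Γ(M)` lying over `Γ(N)` is in `K_θ`. [cite:
CalegariDimitrovTang2025, Corollary 4.5.3] -/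
theorem pow_mem_subgroupOf_ker {p : ℕ} (hQ : ∀ q : Q, q ^ p = 1) (x : Gamma M) (hxN : (x : SL(2, ℤ)) ∈ Gamma N) :
    x ^ p ∈ (θ.ker.map (Gamma N).subtype).subgroupOf (Gamma M) := by
  rw [mem_subgroupOf_ker_iff]
  refine ⟨by rw [Subgroup.coe_pow]; exact pow_mem hxN p, ?_⟩
  have : (⟨((x ^ p : Gamma M) : SL(2, ℤ)), by rw [Subgroup.coe_pow]; exact pow_mem hxN p⟩ : Gamma N) =
      ⟨(x : SL(2, ℤ)), hxN⟩ ^ p := Subtype.ext (by simp)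
  rw [this, map_pow, hQ]

end

/-- **The local condition at `ℓ = p ≥ 5` for the factor `SL₂(ℤ/p^e)` of `SL₂(ℤ/N)`, `N = p^e M`, `p ∤ M`** (the
«hard residue» of the invariant form of CDT Cor. 4.5.3): for an `SL₂(ℤ)`-invariant `θ : Γ(p^e M) → Q` with `Q`
commutative of exponent `p`, `θ` kills `Γ(N) ∩ ([Γ(M), Γ(M)]·K_θ)`.  Proof: `Γ(M)/(K_θ ∩ Γ(M)) → SL₂(ℤ/p^e)`
(reduction; onto by strong approximation `IharaAmalgam.exists_mem_Gamma_forall_dvd_sub`; kernel `Γ(N)/K_θ`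
central of exponent `p` by invariance) is a central extension to which Beyl's theorem
`SL2SchurMultiplier.eq_one_of_mem_ker_of_mem_commutator` applies.  Consumed by the gluing
`local_Gamma_of_local_Gamma_mul` over the prime factorisation of the level. [cite: Beyl1986, Theorem
(M(SL(2,ℤ/m)) = 0 for 4 ∤ m), p-primary part] -/
theorem local_condition_primePow {p e M : ℕ} [Fact p.Prime] (hp5 : 5 ≤ p) (hM : p.Coprime M)
    (hQ : ∀ q : Q, q ^ p = 1) (θ : Gamma (p ^ e * M) →* Q)
    (hθ : ∀ (g x : SL(2, ℤ)) (hx : x ∈ Gamma (p ^ e * M)) (hgx : g * x * g⁻¹ ∈ Gamma (p ^ e * M)),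
      θ ⟨g * x * g⁻¹, hgx⟩ = θ ⟨x, hx⟩) :
    ∀ (y : SL(2, ℤ)) (hy : y ∈ Gamma (p ^ e * M)),
      y ∈ ⁅Gamma M, Gamma M⁆ ⊔ θ.ker.map (Gamma (p ^ e * M)).subtype → θ ⟨y, hy⟩ = 1 := by
  intro y hy hyc
  have hp : p.Prime := Fact.out
  have hNM : Gamma (p ^ e * M) ≤ Gamma M := Wohlfahrt.Gamma_le_Gamma_of_dvd (dvd_mul_left M (p ^ e))
  have hNp : Gamma (p ^ e * M) ≤ Gamma (p ^ e) := Wohlfahrt.Gamma_le_Gamma_of_dvd (dvd_mul_right (p ^ e) M)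
  have hcopM : (p ^ e).Coprime M := Nat.Coprime.pow_left e hM
  haveI hKn : (θ.ker.map (Gamma (p ^ e * M)).subtype).Normal := ker_map_subtype_normal θ hθ
  haveI : ((θ.ker.map (Gamma (p ^ e * M)).subtype).subgroupOf (Gamma M)).Normal := inferInstance
  -- the reduction and the central extension
  have hK'ρ : (θ.ker.map (Gamma (p ^ e * M)).subtype).subgroupOf (Gamma M) ≤
      ((Matrix.SpecialLinearGroup.map (n := Fin 2) (Int.castRingHom (ZMod (p ^ e)))).comp
        (Gamma M).subtype).ker := by
    intro g hg
    obtain ⟨hgN, -⟩ := (mem_subgroupOf_ker_iff θ g).mp hg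
    rw [MonoidHom.mem_ker, MonoidHom.comp_apply, Subgroup.coe_subtype, ← Gamma_mem']
    exact hNp hgN
  let π : Gamma M ⧸ (θ.ker.map (Gamma (p ^ e * M)).subtype).subgroupOf (Gamma M) →* SL(2, ZMod (p ^ e)) :=
    QuotientGroup.lift _ _ hK'ρ
  have hπmk : ∀ g : Gamma M, π (QuotientGroup.mk g) =
      Matrix.SpecialLinearGroup.map (Int.castRingHom (ZMod (p ^ e))) (g : SL(2, ℤ)) := fun g ↦ rfl
  -- surjective
  have hsurj : Function.Surjective π := by
    intro X
    haveI : NeZero (p ^ e) := ⟨pow_ne_zero _ hp.ne_zero⟩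
    obtain ⟨B, hB⟩ :=
      Literature.NumberTheory.EllipticCurves.ModularForms.specialLinearGroup_map_surjective (p ^ e) X
    obtain ⟨γ, hγ, hγB⟩ := IharaAmalgam.exists_mem_Gamma_forall_dvd_sub hcopM.symm B
    refine ⟨QuotientGroup.mk ⟨γ, hγ⟩, ?_⟩
    rw [hπmk, ← hB]
    exact map_eq_map_of_forall_dvd_sub (by exact_mod_cast hγB)
  -- kernel elements lie over Γ(N)
  have hkerN : ∀ g : Gamma M, π (QuotientGroup.mk g) = 1 → (g : SL(2, ℤ)) ∈ Gamma (p ^ e * M) := by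
    intro g hg
    rw [hπmk, ← Gamma_mem'] at hg
    exact mem_Gamma_mul_of_coprime hcopM hg g.2
  have hcen : ∀ z, π z = 1 → ∀ g, g * z = z * g := by
    intro z hz g
    induction z using QuotientGroup.induction_on with
    | H x =>
      induction g using QuotientGroup.induction_on with
      | H y =>
        rw [← QuotientGroup.mk_mul, ← QuotientGroup.mk_mul, QuotientGroup.eq]
        exact comm_mem_subgroupOf_ker θ hθ x y (hkerN x hz)
  have hexp : ∀ z, π z = 1 → z ^ p = 1 := by
    intro z hz
    induction z using QuotientGroup.induction_on with
    | H x =>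
      rw [← QuotientGroup.mk_pow, QuotientGroup.eq_one_iff]
      exact pow_mem_subgroupOf_ker θ hQ x (hkerN x hz)
  -- decompose y = c * k
  obtain ⟨c, hc, k, hk, hck⟩ := Subgroup.mem_sup_of_normal_right.mp hyc
  haveI : (Gamma M).Normal := Gamma_normal M
  have hcM : c ∈ Gamma M := (Subgroup.commutator_le_left (Gamma M) (Gamma M)) hc
  obtain ⟨hkN, hk1⟩ := (mem_ker_map_subtype_iff θ).mp hk
  have hkM : k ∈ Gamma M := hNM hkN
  have hyM : y ∈ Gamma M := hNM hy
  have hcls : (QuotientGroup.mk (⟨y, hyM⟩ : Gamma M) :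
      Gamma M ⧸ (θ.ker.map (Gamma (p ^ e * M)).subtype).subgroupOf (Gamma M)) = QuotientGroup.mk ⟨c, hcM⟩ := by
    have : (⟨y, hyM⟩ : Gamma M) = ⟨c, hcM⟩ * ⟨k, hkM⟩ :=
      Subtype.ext (by rw [Subgroup.coe_mul]; exact hck.symm)
    rw [this, QuotientGroup.mk_mul]
    have hk' : (⟨k, hkM⟩ : Gamma M) ∈ (θ.ker.map (Gamma (p ^ e * M)).subtype).subgroupOf (Gamma M) :=
      (mem_subgroupOf_ker_iff θ _).mpr ⟨hkN, hk1⟩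
    rw [(QuotientGroup.eq_one_iff _).mpr hk', mul_one]
  have hcomm : (QuotientGroup.mk (⟨c, hcM⟩ : Gamma M) :
      Gamma M ⧸ (θ.ker.map (Gamma (p ^ e * M)).subtype).subgroupOf (Gamma M)) ∈ commutator _ := by
    have h1 : (⟨c, hcM⟩ : Gamma M) ∈ commutator (Gamma M) := by
      have h2 : (commutator (Gamma M)).map (Gamma M).subtype = ⁅Gamma M, Gamma M⁆ := by
        rw [commutator_def, Subgroup.map_commutator, ← MonoidHom.range_eq_map, Subgroup.range_subtype]
      rw [← h2] at hc
      obtain ⟨c', hc', hcc'⟩ := hc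
      have : c' = ⟨c, hcM⟩ := Subtype.ext hcc'
      rwa [this] at hc'
    have := Subgroup.mem_map_of_mem (QuotientGroup.mk' ((θ.ker.map (Gamma (p ^ e * M)).subtype).subgroupOf
      (Gamma M))) h1
    rw [commutator_def, Subgroup.map_commutator] at this
    rw [commutator_def]
    exact Subgroup.commutator_mono le_top le_top this
  have hπy : π (QuotientGroup.mk (⟨y, hyM⟩ : Gamma M)) = 1 := by
    rw [hπmk, ← Gamma_mem']
    exact hNp hy
  rw [hcls] at hπy
  have key := SL2SchurMultiplier.eq_one_of_mem_ker_of_mem_commutator p hp5 e π hsurj hcen hexp hπy hcomm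
  rw [← hcls, QuotientGroup.eq_one_iff, mem_subgroupOf_ker_iff] at key
  obtain ⟨_, h⟩ := key
  exact h

/-- The same local condition with the level given as `N` together with a factorisation `N = p^e M`. [cite:
Beyl1986, Theorem (M(SL(2,ℤ/m)) = 0 for 4 ∤ m), p-primary part] -/
theorem local_condition_of_eq_primePow_mul {N p e M : ℕ} [Fact p.Prime] (hN : N = p ^ e * M) (hp5 : 5 ≤ p)
    (hM : p.Coprime M) (hQ : ∀ q : Q, q ^ p = 1) (θ : Gamma N →* Q)
    (hθ : ∀ (g x : SL(2, ℤ)) (hx : x ∈ Gamma N) (hgx : g * x * g⁻¹ ∈ Gamma N), θ ⟨g * x * g⁻¹, hgx⟩ = θ ⟨x, hx⟩) :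
    ∀ (y : SL(2, ℤ)) (hy : y ∈ Gamma N), y ∈ ⁅Gamma M, Gamma M⁆ ⊔ θ.ker.map (Gamma N).subtype → θ ⟨y, hy⟩ = 1 := by
  subst hN
  exact local_condition_primePow hp5 hM hQ θ hθ

/-- **The invariant form of CDT Cor. 4.5.3 at prime-power level `N = p^e` (`p ≥ 5`) for targets of exponent
`p`**: every `SL₂(ℤ)`-conjugation-invariant `θ : Γ(p^e) → Q`, `Q` finite commutative with `q^p = 1` for all `q`,
kills `Γ(12 p^e)` (local condition for `H = SL₂(ℤ)` + `cor453_invariant_form_of_local`).  With the tree's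
prime-level and Sylow-local files this leaves, of the invariant form, only the primes `p = 2` (`4 ∣ N`) and `p =
3` (`9 ∣ N`). [cite: CalegariDimitrovTang2025, Corollary 4.5.3] -/
theorem cor453_invariant_form_primePow_of_exponent {p e : ℕ} [Fact p.Prime] (hp5 : 5 ≤ p) (Q : Type*)
    [CommGroup Q] [Finite Q] (hQ : ∀ q : Q, q ^ p = 1) (θ : Gamma (p ^ e) →* Q)
    (hθ : ∀ (g x : SL(2, ℤ)) (hx : x ∈ Gamma (p ^ e)) (hgx : g * x * g⁻¹ ∈ Gamma (p ^ e)),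
      θ ⟨g * x * g⁻¹, hgx⟩ = θ ⟨x, hx⟩) :
    ∃ M : ℕ, M ≠ 0 ∧ ∀ (x : SL(2, ℤ)) (hx : x ∈ Gamma (p ^ e)), x ∈ Gamma M → θ ⟨x, hx⟩ = 1 := by
  have hp : p.Prime := Fact.out
  have loc := local_condition_of_eq_primePow_mul (N := p ^ e) (M := 1) (by rw [mul_one]) hp5
    (Nat.coprime_one_right p) hQ θ hθ
  rw [Gamma_one_top] at loc
  exact cor453_invariant_form_of_local (p ^ e) (pow_ne_zero _ hp.ne_zero) Q θ hθ ⊤ le_top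
    (by rw [Subgroup.index_top]; exact Nat.coprime_one_right _) loc

end UnboundedDenominators

end Literature.NumberTheory.Automorphic
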